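import Summits.QuantumFields.YangMills.Theorems.F4SubCurvatureDoorShortRootRigidityPlanarApertureStep
import Summits.QuantumFields.YangMills.Theorems.F4SubCurvatureDoorShortRootRigidityPlanarConeSupport
import HarnessLib

/-!
# LINE g20-A / g21-C (crux ⟨stmt-QuantumFields-23035⟩ `ShortRootRigidity`) — «PLANAR CONE SUPPORT» BY NAME, unconditional

`PlanarConeSupport` (the support form of (C) `stub_planarSpectralCone`; rungs file `Cruxes/ShortRootRigidity/Lines/angular_type_rungs.lean` v3 and
skeleton `Lines/aperture_bootstrap.lean` :110, character-identical restatement in `…PlanarConeSupport`, this seat p723103) holds outright: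
`planarConeSupport_of_apertureStep` (p723103) ∘ `stub_planarApertureStep` (R-S3d, p724234) ∘ `flatDoubleEdge_holds` (R-S3b, p723152).
Every Laplace–Fourier measure of a frame of a planar-class kernel is carried by the forward light cone `{E ≥ |p|}`.

HONEST LABEL: the support form of (C) as a tree theorem; (C) by name is w3 g38's cone packaging `:141` applied to this; the crux ⟨23035⟩ still
needs the shared stub `stub_oddModeRigidity`; ⟨23125⟩, R2d and the Yang–Mills mass gap remain OPEN; no summit is proved by a line.  Lead seat
`ym-line-sfw-p2` g75 (cell ym-idea-1, free hands).
-/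

set_option autoImplicit false

namespace Summit.QuantumFields.YangMills.Theorems.F4SubCurvatureDoorPlanarConeSupportByName

open Summit.QuantumFields.YangMills.Theorems.F4SubCurvatureDoorPlanarConeSupportRegistered (PlanarConeSupport planarConeSupport_of_apertureStep)
open Summit.QuantumFields.YangMills.Theorems.F4SubCurvatureDoorPlanarApertureStepByName (stub_planarApertureStep)
open Summit.QuantumFields.YangMills.Theorems.F4SubCurvatureDoorFlatDoubleEdgeRegistered (flatDoubleEdge_holds)

/-- **«PLANAR CONE SUPPORT» (by name), unconditional**: the frame Laplace–Fourier measure of every planar-class kernel has aperture `1`. -/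
theorem planarConeSupport_holds : PlanarConeSupport :=
  planarConeSupport_of_apertureStep (stub_planarApertureStep flatDoubleEdge_holds)

end Summit.QuantumFields.YangMills.Theorems.F4SubCurvatureDoorPlanarConeSupportByName
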